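import Mathlib
import Literature.NumberTheory.LFunctions.Zhang2022.SkeletonPartThree
import HarnessLib

/-!
# Zhang (2022), typed skeleton — shared window lemmas: `(pt₀)^{β_j} = ∓1 + O(α₁)` for `p ∼ P`,
# `𝔞 ≪ 𝓛⁴`, and the window-sum bookkeeping behind (7.9), (16.16), (17.6), (17.9)

Topic `Literature/NumberTheory/LFunctions/Zhang2022` (Landau–Siegel audit tree; verdict-neutral).
Y. Zhang, *Discrete mean estimates and the Landau–Siegel zero*, arXiv:2211.02515v1 (2022)
[Zhang2022LandauSiegel] — an unrefereed manuscript under adjudication. This file PROVES, once, the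
small un-displayed steps that the section computations of §7, §16 and §17 all invoke:

* "Note that `(pt₀)^{β₃} = −1 + O(α₁)`" (§7 p. 37, proof of Proposition 7.1, tex L1972; again §17
  p. 96 before (17.6), tex L4762), "Since `(pt₀)^{β₁} = −1 + O(α₁)`" (§16 p. 95 before (16.17),
  tex L4686), "Since `(pt₀)^{β₂} = 1 + O(α₁)`" (§17 p. 99 before (17.9), tex L4848) — uniformly for
  `p ∼ P`, with `α₁` read as `α𝓛` (`α₁` is undefined in v1; this is the skeleton's standing reading):
  `norm_pt0_cpow_beta1_add_one_le`, `norm_pt0_cpow_beta2_sub_one_le`, `norm_pt0_cpow_beta3_add_one_le`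
  (from (2.13) `β₁ = iα(1−5c′α𝓛)`, `β₂ = 2iα(1+c′α𝓛)`, `β₃ = 3iα(1−c′α𝓛)`, (2.10) `α log P = π`,
  (2.8) `t₀ = 𝓛⁵¹⁹`, and `P < p < P(1+𝓛⁻⁶⁸)`);
* the size facts used whenever an `O(α₁)·𝔞·p` is absorbed into `o(p)`: `𝔞 ≤ C𝓛⁴` (the tree's
  `Skeleton.frakA_le_ell_pow_four` in `Section10Theta1Evals`; a private copy here keeps this file's
  imports to the skeleton) and `p ≤ 2P` on the window;
* the bookkeeping step "`Σ_{p∼P}(pt₀)^{β}Φ(p)` with `Φ(p) = c·p·X + o(p)` uniformly in `p`,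
  `X = 𝔞 + o(1)`, `(pt₀)^β = u + O(α₁)` ⇒ `= u·c·𝔞·𝔓 + o(𝔓)`" as ONE inequality at fixed `D`
  (`norm_window_sum_sub_le`) and in the skeleton's eventual shape (`window_sum_eval`), so that the
  deductions (7.9)→Prop. 7.1, (16.16)→(16.17), (17.2)+(17.5)+Lemma 17.1→(17.6), (17.7)+(17.8)→(17.9)
  instantiate it in one line each.

Nothing here bears on Theorems 1–2 of the manuscript; no node of the skeleton is restated.

## References

* Y. Zhang, arXiv:2211.02515v1 (2022), §2 (2.8), (2.10), (2.13); §7 p. 37; §16 p. 95; §17 pp. 96, 99.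
  [cite: Zhang2022LandauSiegel, §2 (2.13); §7; §16; §17]
-/

noncomputable section

open Complex Real

namespace Literature.NumberTheory.LFunctions.Zhang2022.Skeleton

/-! ## §1. The prime window `p ∼ P`: `P < p < P(1 + 𝓛⁻⁶⁸)` -/

/-- `P = exp(𝓛⁹) > 0`. [cite: Zhang2022LandauSiegel, §2 (2.6)] -/
theorem bigP_pos (D : ℕ) : 0 < bigP D := Real.exp_pos _

/-- `p ∼ P` implies `P < p`. [cite: Zhang2022LandauSiegel, §2 p. 4] -/
theorem bigP_lt_of_mem_primeWindow {D p : ℕ} (hp : p ∈ primeWindow D) : bigP D < p := by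
  have h := (Finset.mem_Ioo.mp (Finset.mem_filter.mp hp).1).1
  have h' : (⌊bigP D⌋₊ : ℝ) + 1 ≤ p := by exact_mod_cast h
  exact lt_of_lt_of_le (Nat.lt_floor_add_one (bigP D)) h'

/-- `p ∼ P` implies `p < P(1 + 𝓛⁻⁶⁸)`. [cite: Zhang2022LandauSiegel, §2 p. 4] -/
theorem lt_of_mem_primeWindow {D p : ℕ} (hp : p ∈ primeWindow D) :
    (p : ℝ) < bigP D * (1 + (ell D ^ 68)⁻¹) := by
  have h := (Finset.mem_Ioo.mp (Finset.mem_filter.mp hp).1).2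
  exact Nat.lt_ceil.mp h

/-- `p ∼ P` implies `p` is prime. [cite: Zhang2022LandauSiegel, §2 p. 4] -/
theorem prime_of_mem_primeWindow' {D p : ℕ} (hp : p ∈ primeWindow D) : p.Prime :=
  (Finset.mem_filter.mp hp).2

/-- `p ∼ P` implies `0 < p` (as a real number). [cite: Zhang2022LandauSiegel, §2 p. 4] -/
theorem pos_of_mem_primeWindow {D p : ℕ} (hp : p ∈ primeWindow D) : (0 : ℝ) < p :=
  lt_trans (bigP_pos D) (bigP_lt_of_mem_primeWindow hp)

/-- `p ∼ P` implies `p ≤ 2P` (since `𝓛⁻⁶⁸ ≤ 1` once `𝓛 ≥ 1`). [cite: Zhang2022LandauSiegel, §2 p. 4] -/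
theorem le_two_mul_bigP_of_mem_primeWindow {D p : ℕ} (hD : 1 ≤ ell D) (hp : p ∈ primeWindow D) :
    (p : ℝ) ≤ 2 * bigP D := by
  have h := lt_of_mem_primeWindow hp
  have ha : (ell D ^ 68)⁻¹ ≤ 1 := inv_le_one_of_one_le₀ (one_le_pow₀ hD)
  have hP := bigP_pos D
  nlinarith

/-- `p ∼ P` implies `log P < log p`. [cite: Zhang2022LandauSiegel, §2 p. 4] -/
theorem log_bigP_lt_log_of_mem_primeWindow {D p : ℕ} (hp : p ∈ primeWindow D) :
    Real.log (bigP D) < Real.log p :=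
  Real.log_lt_log (bigP_pos D) (bigP_lt_of_mem_primeWindow hp)

/-- `p ∼ P` implies `log p ≤ log P + 𝓛⁻⁶⁸` (`log(1+a) ≤ a`). [cite: Zhang2022LandauSiegel, §2 p. 4] -/
theorem log_le_log_bigP_add_of_mem_primeWindow {D p : ℕ} (hD : 1 ≤ ell D)
    (hp : p ∈ primeWindow D) : Real.log p ≤ Real.log (bigP D) + (ell D ^ 68)⁻¹ := by
  have h := lt_of_mem_primeWindow hp
  have hP := bigP_pos D
  have ha : 0 < (ell D ^ 68)⁻¹ := inv_pos.mpr (pow_pos (by linarith) _)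
  have h1 : Real.log p ≤ Real.log (bigP D * (1 + (ell D ^ 68)⁻¹)) :=
    Real.log_le_log (pos_of_mem_primeWindow hp) h.le
  rw [Real.log_mul hP.ne' (by linarith)] at h1
  have h2 : Real.log (1 + (ell D ^ 68)⁻¹) ≤ (ell D ^ 68)⁻¹ := by
    have := Real.log_le_sub_one_of_pos (by linarith : (0 : ℝ) < 1 + (ell D ^ 68)⁻¹)
    linarith
  linarith

/-- `α log P = π` (2.10) (for `𝓛 ≠ 0`, i.e. `D ≥ 2`). [cite: Zhang2022LandauSiegel, §2 (2.10)] -/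
theorem alpha_mul_log_bigP {D : ℕ} (hD : ell D ≠ 0) : alpha D * Real.log (bigP D) = π := by
  rw [alpha, log_bigP D]
  field_simp

/-- `0 < α` once `𝓛 > 0`. [cite: Zhang2022LandauSiegel, §2 (2.10)] -/
theorem alpha_pos' {D : ℕ} (hD : 0 < ell D) : 0 < alpha D := by
  rw [alpha, log_bigP D]; positivity

/-! ## §2. `(pt₀)^{β_j} = ∓1 + O(α₁)` uniformly for `p ∼ P` -/

/-- For `x > 0` real and `θ` real, `x^{iθ} = e^{iθ log x}`. [folklore] -/
private theorem ofReal_cpow_mul_I {x : ℝ} (hx : 0 < x) (θ : ℝ) :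
    (x : ℂ) ^ ((θ : ℂ) * I) = Complex.exp (I * ((θ * Real.log x : ℝ) : ℂ)) := by
  rw [Complex.cpow_def_of_ne_zero (by exact_mod_cast hx.ne'), ← Complex.ofReal_log hx.le]
  congr 1
  push_cast
  ring

/-- `‖e^{ia} − e^{ib}‖ ≤ |a − b|` for real `a, b`. [folklore] -/
private theorem norm_exp_I_mul_sub_exp_I_mul_le (a b : ℝ) :
    ‖Complex.exp (I * (a : ℂ)) - Complex.exp (I * (b : ℂ))‖ ≤ |a - b| := by
  have h : Complex.exp (I * (a : ℂ)) - Complex.exp (I * (b : ℂ)) =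
      Complex.exp (I * (b : ℂ)) * (Complex.exp (I * ((a - b : ℝ) : ℂ)) - 1) := by
    rw [mul_sub, mul_one, ← Complex.exp_add]
    push_cast
    ring_nf
  rw [h, norm_mul, Complex.norm_exp_I_mul_ofReal, one_mul]
  exact (Real.norm_exp_I_mul_ofReal_sub_one_le).trans (le_of_eq (Real.norm_eq_abs _))

/-- **The core estimate.** For `p ∼ P`, `𝓛 ≥ 2`, a real multiplier `r` and a natural `k`:
`‖(pt₀)^{ikαr} − e^{ikπ}‖ ≤ k(520 α𝓛 + |r − 1|(π + 520 α𝓛))`. Here `α log(pt₀) − π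
= α(log(p/P) + log t₀) ∈ [0, α(𝓛⁻⁶⁸ + 519 log 𝓛)] ⊂ [0, 520 α𝓛]`.
[cite: Zhang2022LandauSiegel, §7 p. 37; §16 p. 95; §17 pp. 96, 99] -/
theorem norm_pt0_cpow_sub_exp_le {D p : ℕ} (hD : 2 ≤ ell D) (hp : p ∈ primeWindow D)
    (k : ℕ) (r : ℝ) :
    ‖(((p : ℝ) * t0 D : ℝ) : ℂ) ^ (((k * alpha D * r : ℝ) : ℂ) * I) -
        Complex.exp (I * ((k * π : ℝ) : ℂ))‖ ≤
      k * (520 * (alpha D * ell D) + |r - 1| * (π + 520 * (alpha D * ell D))) := by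
  have hℓ0 : 0 < ell D := by linarith
  have hℓ1 : 1 ≤ ell D := by linarith
  have hp0 : (0 : ℝ) < p := pos_of_mem_primeWindow hp
  have ht0 : 0 < t0 D := pow_pos hℓ0 _
  have hx : 0 < (p : ℝ) * t0 D := mul_pos hp0 ht0
  have hα : 0 < alpha D := alpha_pos' hℓ0
  rw [ofReal_cpow_mul_I hx]
  refine (norm_exp_I_mul_sub_exp_I_mul_le _ _).trans ?_
  -- the phase: `kαr log(pt₀) − kπ = k[(α log(pt₀) − π) + (r − 1) α log(pt₀)]`
  have hlogx : Real.log ((p : ℝ) * t0 D) = Real.log p + Real.log (t0 D) :=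
    Real.log_mul hp0.ne' ht0.ne'
  -- `0 ≤ α log(pt₀) − π ≤ 520 α𝓛`
  have hlogt0 : Real.log (t0 D) = 519 * Real.log (ell D) := by
    rw [t0, Real.log_pow]; norm_num
  have hlogℓ : Real.log (ell D) ≤ ell D := by
    have := Real.add_one_le_exp (Real.log (ell D))
    rw [Real.exp_log hℓ0] at this; linarith
  have hlogℓ0 : 0 ≤ Real.log (ell D) := Real.log_nonneg hℓ1
  have hαP : alpha D * Real.log (bigP D) = π := alpha_mul_log_bigP hℓ0.ne'
  have hlo : Real.log (bigP D) < Real.log p := log_bigP_lt_log_of_mem_primeWindow hp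
  have hhi : Real.log p ≤ Real.log (bigP D) + (ell D ^ 68)⁻¹ :=
    log_le_log_bigP_add_of_mem_primeWindow hℓ1 hp
  have ha1 : (ell D ^ 68)⁻¹ ≤ 1 := inv_le_one_of_one_le₀ (one_le_pow₀ hℓ1)
  set Φ : ℝ := alpha D * Real.log ((p : ℝ) * t0 D) with hΦdef
  have hΦlo : π ≤ Φ := by
    rw [hΦdef, hlogx, mul_add, ← hαP]
    nlinarith [mul_nonneg hα.le hlogℓ0]
  have hΦhi : Φ ≤ π + 520 * (alpha D * ell D) := by
    rw [hΦdef, hlogx, mul_add, ← hαP, hlogt0]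
    nlinarith [mul_nonneg hα.le hlogℓ0]
  have hΦ0 : 0 ≤ Φ := le_trans Real.pi_pos.le hΦlo
  -- assemble
  have key : (k : ℝ) * alpha D * r * Real.log ((p : ℝ) * t0 D) - k * π =
      k * ((Φ - π) + (r - 1) * Φ) := by rw [hΦdef]; ring
  rw [key, abs_mul, Nat.abs_cast]
  refine mul_le_mul_of_nonneg_left ?_ (Nat.cast_nonneg k)
  calc |Φ - π + (r - 1) * Φ| ≤ |Φ - π| + |(r - 1) * Φ| := abs_add_le _ _
    _ = (Φ - π) + |r - 1| * Φ := by rw [abs_of_nonneg (by linarith), abs_mul, abs_of_nonneg hΦ0]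
    _ ≤ 520 * (alpha D * ell D) + |r - 1| * (π + 520 * (alpha D * ell D)) := by
        gcongr
        · linarith

/-- `α𝓛 ≤ 1` once `𝓛 ≥ 2` (`α𝓛 = π𝓛⁻⁸`). [cite: Zhang2022LandauSiegel, §2 (2.10)] -/
theorem alpha_mul_ell_le_one {D : ℕ} (hD : 2 ≤ ell D) : alpha D * ell D ≤ 1 := by
  have hℓ0 : 0 < ell D := by linarith
  rw [alpha, log_bigP D, div_mul_eq_mul_div, div_le_one (pow_pos hℓ0 9)]
  have h8 : π ≤ ell D ^ 8 :=
    calc π ≤ 4 := Real.pi_le_four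
      _ ≤ 2 ^ 8 := by norm_num
      _ ≤ ell D ^ 8 := pow_le_pow_left₀ (by norm_num) hD 8
  calc π * ell D ≤ ell D ^ 8 * ell D := mul_le_mul_of_nonneg_right h8 hℓ0.le
    _ = ell D ^ 9 := by ring

/-- The three exponents of (2.13) in the form `ikαr`: `β₁ = i·1·α·(1 − 5c′α𝓛)`.
[cite: Zhang2022LandauSiegel, §2 (2.13)] -/
theorem beta1_eq_mul_I (c' : ℝ) (D : ℕ) :
    beta1 c' D = (((1 : ℕ) * alpha D * (1 - 5 * c' * alpha D * ell D) : ℝ) : ℂ) * I := by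
  rw [beta1]; push_cast; ring

/-- `β₂ = i·2·α·(1 + c′α𝓛)`. [cite: Zhang2022LandauSiegel, §2 (2.13)] -/
theorem beta2_eq_mul_I (c' : ℝ) (D : ℕ) :
    beta2 c' D = (((2 : ℕ) * alpha D * (1 + c' * alpha D * ell D) : ℝ) : ℂ) * I := by
  rw [beta2]; push_cast; ring

/-- `β₃ = i·3·α·(1 − c′α𝓛)`. [cite: Zhang2022LandauSiegel, §2 (2.13)] -/
theorem beta3_eq_mul_I (c' : ℝ) (D : ℕ) :
    beta3 c' D = (((3 : ℕ) * alpha D * (1 - c' * alpha D * ell D) : ℝ) : ℂ) * I := by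
  rw [beta3]; push_cast; ring

/-- `e^{iπ} = −1`, `e^{2iπ} = 1`, `e^{3iπ} = −1` in the form used above. [folklore] -/
private theorem exp_I_mul_nat_mul_pi (k : ℕ) :
    Complex.exp (I * ((k * π : ℝ) : ℂ)) = (-1) ^ k := by
  have : I * ((k * π : ℝ) : ℂ) = k * (π * I) := by push_cast; ring
  rw [this, Complex.exp_nat_mul, Complex.exp_pi_mul_I]

/-- **"`(pt₀)^{β₁} = −1 + O(α₁)`"** (§16 p. 95, tex L4686), uniformly for `p ∼ P`, for every fixed
`c′`: for `𝓛 ≥ 2`, `‖(pt₀)^{β₁} + 1‖ ≤ (520 + 5|c′|(π + 520))·α𝓛`.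
[cite: Zhang2022LandauSiegel, §16 p. 95] -/
theorem norm_pt0_cpow_beta1_add_one_le (c' : ℝ) {D p : ℕ} (hD : 2 ≤ ell D)
    (hp : p ∈ primeWindow D) :
    ‖(((p : ℝ) * t0 D : ℝ) : ℂ) ^ beta1 c' D + 1‖ ≤
      (520 + 5 * |c'| * (π + 520)) * (alpha D * ell D) := by
  have h := norm_pt0_cpow_sub_exp_le hD hp 1 (1 - 5 * c' * alpha D * ell D)
  rw [exp_I_mul_nat_mul_pi, ← beta1_eq_mul_I] at h
  simp only [pow_one, sub_neg_eq_add, Nat.cast_one, one_mul] at h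
  refine h.trans ?_
  have hαℓ : 0 ≤ alpha D * ell D := mul_nonneg (alpha_pos' (by linarith)).le (by linarith)
  have hαℓ1 := alpha_mul_ell_le_one hD
  have hr : |1 - 5 * c' * alpha D * ell D - 1| = 5 * |c'| * (alpha D * ell D) := by
    rw [show 1 - 5 * c' * alpha D * ell D - 1 = -(5 * c' * (alpha D * ell D)) by ring, abs_neg,
      abs_mul, abs_mul, abs_of_nonneg hαℓ, abs_of_nonneg (by norm_num : (0:ℝ) ≤ 5)]
  rw [hr]
  have hπ : 0 ≤ π := Real.pi_pos.le
  nlinarith [abs_nonneg c', mul_nonneg (abs_nonneg c') hαℓ]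

/-- **"`(pt₀)^{β₂} = 1 + O(α₁)`"** (§17 p. 99, tex L4848), uniformly for `p ∼ P`: for `𝓛 ≥ 2`,
`‖(pt₀)^{β₂} − 1‖ ≤ 2(520 + |c′|(π + 520))·α𝓛`. [cite: Zhang2022LandauSiegel, §17 p. 99] -/
theorem norm_pt0_cpow_beta2_sub_one_le (c' : ℝ) {D p : ℕ} (hD : 2 ≤ ell D)
    (hp : p ∈ primeWindow D) :
    ‖(((p : ℝ) * t0 D : ℝ) : ℂ) ^ beta2 c' D - 1‖ ≤
      2 * (520 + |c'| * (π + 520)) * (alpha D * ell D) := by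
  have h := norm_pt0_cpow_sub_exp_le hD hp 2 (1 + c' * alpha D * ell D)
  rw [exp_I_mul_nat_mul_pi, ← beta2_eq_mul_I, neg_one_sq] at h
  simp only [Nat.cast_ofNat, add_sub_cancel_left] at h
  refine h.trans ?_
  have hαℓ : 0 ≤ alpha D * ell D := mul_nonneg (alpha_pos' (by linarith)).le (by linarith)
  have hαℓ1 := alpha_mul_ell_le_one hD
  have hr : |c' * alpha D * ell D| = |c'| * (alpha D * ell D) := by
    rw [mul_assoc, abs_mul, abs_of_nonneg hαℓ]
  rw [hr]
  have hπ : 0 ≤ π := Real.pi_pos.le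
  nlinarith [abs_nonneg c', mul_nonneg (abs_nonneg c') hαℓ]

/-- **"`(pt₀)^{β₃} = −1 + O(α₁)`"** (§7 p. 37, tex L1972; §17 p. 96, tex L4762), uniformly for
`p ∼ P`: for `𝓛 ≥ 2`, `‖(pt₀)^{β₃} + 1‖ ≤ 3(520 + |c′|(π + 520))·α𝓛`.
[cite: Zhang2022LandauSiegel, §7 p. 37; §17 p. 96] -/
theorem norm_pt0_cpow_beta3_add_one_le (c' : ℝ) {D p : ℕ} (hD : 2 ≤ ell D)
    (hp : p ∈ primeWindow D) :
    ‖(((p : ℝ) * t0 D : ℝ) : ℂ) ^ beta3 c' D + 1‖ ≤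
      3 * (520 + |c'| * (π + 520)) * (alpha D * ell D) := by
  have h := norm_pt0_cpow_sub_exp_le hD hp 3 (1 - c' * alpha D * ell D)
  have h3 : ((-1 : ℂ)) ^ (3 : ℕ) = -1 := by norm_num
  rw [exp_I_mul_nat_mul_pi, ← beta3_eq_mul_I, h3, sub_neg_eq_add] at h
  simp only [Nat.cast_ofNat, sub_sub_cancel_left, abs_neg] at h
  refine h.trans ?_
  have hαℓ : 0 ≤ alpha D * ell D := mul_nonneg (alpha_pos' (by linarith)).le (by linarith)
  have hαℓ1 := alpha_mul_ell_le_one hD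
  have hr : |c' * alpha D * ell D| = |c'| * (alpha D * ell D) := by
    rw [mul_assoc, abs_mul, abs_of_nonneg hαℓ]
  rw [hr]
  have hπ : 0 ≤ π := Real.pi_pos.le
  nlinarith [abs_nonneg c', mul_nonneg (abs_nonneg c') hαℓ]

/-- `‖(pt₀)^{β}‖ = 1` for the purely imaginary exponents `β₁, β₂, β₃` is not needed; what the
bookkeeping uses is the crude consequence `‖(pt₀)^{β_j}‖ ≤ 2` (`𝓛 ≥ 2` and `α𝓛·(…) ≤ 1`), recorded
for `β₃`. [cite: Zhang2022LandauSiegel, §7 p. 37] -/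
theorem norm_pt0_cpow_beta3_le (c' : ℝ) {D p : ℕ} (hD : 2 ≤ ell D)
    (hC : 3 * (520 + |c'| * (π + 520)) * (alpha D * ell D) ≤ 1) (hp : p ∈ primeWindow D) :
    ‖(((p : ℝ) * t0 D : ℝ) : ℂ) ^ beta3 c' D‖ ≤ 2 := by
  have h := norm_pt0_cpow_beta3_add_one_le c' hD hp
  have : ‖(((p : ℝ) * t0 D : ℝ) : ℂ) ^ beta3 c' D‖ ≤
      ‖(((p : ℝ) * t0 D : ℝ) : ℂ) ^ beta3 c' D + 1‖ + ‖(1 : ℂ)‖ := by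
    have := norm_sub_le ((((p : ℝ) * t0 D : ℝ) : ℂ) ^ beta3 c' D + 1) 1
    simpa using this
  rw [norm_one] at this
  linarith

/-! ## §3. `𝔞 ≪ 𝓛⁴` and the window-sum bookkeeping -/

/-- **`𝔞 ≤ C𝓛⁴`** (a private copy, with constant `16e⁹`, of the tree's public
`Skeleton.frakA_le_ell_pow_four` of `Section10Theta1Evals` — constant `96e⁹/π²`; use that one): `𝔞 = (6/π²)L′(1,χ)²∏_{q∣D} q/(q+1)` (2.31) with `|L′(1,χ)| ≤ 2e^{9/2}(1+𝓛)𝓛`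
(`Lemma31.norm_deriv_LFunction_le_near_one`) and the product `≤ 1`; for `χ` primitive, `𝓛 ≥ 3`.
[cite: Zhang2022LandauSiegel, §2 (2.31)] -/
private theorem frakA_le_ell4 {D : ℕ} [NeZero D] (χ : DirichletCharacter ℂ D) (hχ : χ.IsPrimitive)
    (hD : 3 ≤ ell D) : frakA χ ≤ 16 * Real.exp 9 * ell D ^ 4 := by
  have hℓ1 : 1 ≤ ell D := by linarith
  have hL := Lemma31.norm_deriv_LFunction_le_near_one χ hD hχ (w := 1) (by simp; positivity)
  have hprod : ∏ p ∈ D.primeFactors, ((p : ℝ) / (p + 1)) ≤ 1 := by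
    refine Finset.prod_le_one (fun p _ => by positivity) (fun p _ => ?_)
    rw [div_le_one (by positivity)]; linarith
  have hprod0 : 0 ≤ ∏ p ∈ D.primeFactors, ((p : ℝ) / (p + 1)) :=
    Finset.prod_nonneg fun p _ => by positivity
  have hre : (deriv χ.LFunction 1).re ^ 2 ≤ ‖deriv χ.LFunction 1‖ ^ 2 := by
    have h := abs_le.mp (Complex.abs_re_le_norm (deriv χ.LFunction 1))
    exact sq_le_sq' h.1 h.2
  have hn : ‖deriv χ.LFunction 1‖ ≤ 4 * Real.exp (9 / 2) * ell D ^ 2 := by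
    refine hL.trans ?_
    have hℓ : (1 + ell D) * ell D ≤ 2 * ell D ^ 2 := by nlinarith
    have he : 0 < Real.exp (9 / 2) := Real.exp_pos _
    calc 2 * Real.exp (9 / 2) * (1 + Real.log D) * Real.log D
        = 2 * Real.exp (9 / 2) * ((1 + ell D) * ell D) := by rw [ell]; ring
      _ ≤ 2 * Real.exp (9 / 2) * (2 * ell D ^ 2) := by gcongr
      _ = 4 * Real.exp (9 / 2) * ell D ^ 2 := by ring
  have hn0 : 0 ≤ ‖deriv χ.LFunction 1‖ := norm_nonneg _
  have hn2 : ‖deriv χ.LFunction 1‖ ^ 2 ≤ 16 * Real.exp 9 * ell D ^ 4 := by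
    have e9 : Real.exp 9 = Real.exp (9 / 2) ^ 2 := by rw [← Real.exp_nat_mul]; norm_num
    calc ‖deriv χ.LFunction 1‖ ^ 2 ≤ (4 * Real.exp (9 / 2) * ell D ^ 2) ^ 2 :=
          pow_le_pow_left₀ hn0 hn 2
      _ = 16 * Real.exp 9 * ell D ^ 4 := by rw [e9]; ring
  have h6 : 6 / π ^ 2 ≤ 1 := by
    rw [div_le_one (by positivity)]
    nlinarith [Real.pi_gt_three]
  rw [frakA, Lemma171.frakA]
  have hA : 6 / π ^ 2 * (deriv χ.LFunction 1).re ^ 2 ≤ 1 * (16 * Real.exp 9 * ell D ^ 4) :=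
    mul_le_mul h6 (hre.trans hn2) (sq_nonneg _) zero_le_one
  calc 6 / π ^ 2 * (deriv χ.LFunction 1).re ^ 2 * ∏ p ∈ D.primeFactors, ((p : ℝ) / (p + 1))
      ≤ 1 * (16 * Real.exp 9 * ell D ^ 4) * 1 := mul_le_mul hA hprod hprod0 (by positivity)
    _ = 16 * Real.exp 9 * ell D ^ 4 := by ring

/-- **Window-sum bookkeeping at fixed `D`** (the step behind (7.9), (16.16)–(16.17), (17.6), (17.9)):
if `‖w(p) − u‖ ≤ η`, `‖Φ(p) − c·p·X‖ ≤ ε·p` for every `p ∼ P`, and `‖X − A‖ ≤ δ`, then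
`‖Σ_{p∼P} w(p)Φ(p) − u·c·A·𝔓‖ ≤ ((‖u‖+η)ε + (‖u‖+η)‖c‖δ + η‖c‖|A|)·𝔓`.
[cite: Zhang2022LandauSiegel, §17 (17.6)] -/
theorem norm_window_sum_sub_le {D : ℕ} (w Φ : ℕ → ℂ) (u c X : ℂ) (A ε δ η : ℝ)
    (hw : ∀ p ∈ primeWindow D, ‖w p - u‖ ≤ η)
    (hΦ : ∀ p ∈ primeWindow D, ‖Φ p - c * p * X‖ ≤ ε * p) (hX : ‖X - A‖ ≤ δ) :
    ‖∑ p ∈ primeWindow D, w p * Φ p - u * c * A * frakP D‖ ≤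
      ((‖u‖ + η) * ε + (‖u‖ + η) * ‖c‖ * δ + η * ‖c‖ * |A|) * frakP D := by
  rw [frakP_eq_sum_primeWindow, Complex.ofReal_sum, Finset.mul_sum, ← Finset.sum_sub_distrib,
    Finset.mul_sum]
  refine (norm_sum_le _ _).trans (Finset.sum_le_sum fun p hp => ?_)
  have hp0 : (0 : ℝ) ≤ p := Nat.cast_nonneg p
  have hη : 0 ≤ η := le_trans (norm_nonneg _) (hw p hp)
  have hε : ‖Φ p - c * p * X‖ ≤ ε * p := hΦ p hp
  have hwn : ‖w p‖ ≤ ‖u‖ + η := by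
    have := norm_add_le (w p - u) u
    rw [sub_add_cancel] at this
    linarith [hw p hp]
  have key : w p * Φ p - u * c * A * (p : ℝ) =
      w p * (Φ p - c * p * X) + w p * c * p * (X - A) + (w p - u) * c * A * p := by
    push_cast; ring
  rw [key]
  calc ‖w p * (Φ p - c * p * X) + w p * c * p * (X - A) + (w p - u) * c * A * p‖
      ≤ ‖w p * (Φ p - c * p * X)‖ + ‖w p * c * p * (X - A)‖ + ‖(w p - u) * c * A * p‖ :=
        norm_add₃_le
    _ = ‖w p‖ * ‖Φ p - c * p * X‖ + ‖w p‖ * ‖c‖ * p * ‖X - A‖ + ‖w p - u‖ * ‖c‖ * |A| * p := by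
        simp only [norm_mul, Complex.norm_real, Complex.norm_natCast, Real.norm_eq_abs]
    _ ≤ (‖u‖ + η) * (ε * p) + (‖u‖ + η) * ‖c‖ * p * δ + η * ‖c‖ * |A| * p := by
        gcongr
        · exact hw p hp
    _ = ((‖u‖ + η) * ε + (‖u‖ + η) * ‖c‖ * δ + η * ‖c‖ * |A|) * p := by ring


/-! ## §4. The eventual forms consumed by the section computations -/

/-- For every real `M`, `𝓛 = log D ≥ M` for all large `D` ("`D` greater than a sufficiently large
and effectively computable number", §2 p. 4). [cite: Zhang2022LandauSiegel, §2 p. 4] -/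
theorem exists_nat_forall_le_ell (M : ℝ) : ∃ D₀ : ℕ, ∀ D : ℕ, D₀ ≤ D → M ≤ ell D := by
  refine ⟨⌈Real.exp M⌉₊ + 1, fun D hD => ?_⟩
  have h1 : Real.exp M ≤ D := by
    have : (⌈Real.exp M⌉₊ : ℝ) + 1 ≤ D := by exact_mod_cast hD
    linarith [Nat.le_ceil (Real.exp M)]
  have hD0 : (0 : ℝ) < D := lt_of_lt_of_le (Real.exp_pos M) h1
  rw [ell, Real.le_log_iff_exp_le hD0]
  exact h1

/-- **Window-sum bookkeeping, eventual form.** A family of weights `w_D(p)` with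
`w_D(p) = u + O(α𝓛)` on the window (e.g. `(pt₀)^{β_j}`, §2), a family `Φ_{D,χ}(p) = c·p·X_{D,χ} + o(p)`
uniformly for `p ∼ P`, and `X_{D,χ} = 𝔞 + o(1)` give `Σ_{p∼P} w_D(p)Φ_{D,χ}(p) = u·c·𝔞·𝔓 + o(𝔓)` —
the shape in which (7.9)→Prop. 7.1, (16.16)→(16.17), (17.2)+(17.5)+Lemma 17.1→(17.6) and
(17.7)+(17.8)→(17.9) use it (`O(α₁)·𝔞 = O(𝓛⁻⁴) = o(1)` by `𝔞 ≪ 𝓛⁴`).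
[cite: Zhang2022LandauSiegel, §17 (17.6), (17.9)] -/
theorem window_sum_eval {w : ℕ → ℕ → ℂ} {u : ℂ} {Cw : ℝ} {D₁ : ℕ}
    (hw : ∀ D : ℕ, D₁ ≤ D → ∀ p ∈ primeWindow D, ‖w D p - u‖ ≤ Cw * (alpha D * ell D))
    {Φ : (D : ℕ) → DirichletCharacter ℂ D → ℕ → ℂ} {X : (D : ℕ) → DirichletCharacter ℂ D → ℂ}
    {c : ℂ}
    (hΦ : ∀ ε : ℝ, 0 < ε → ForAllLarge fun D _ χ => AssumptionA D χ →
      ∀ p ∈ primeWindow D, ‖Φ D χ p - c * p * X D χ‖ ≤ ε * p)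
    (hX : ∀ δ : ℝ, 0 < δ → ForAllLarge fun D _ χ => AssumptionA D χ → ‖X D χ - frakA χ‖ ≤ δ) :
    ∀ ε : ℝ, 0 < ε → ForAllLarge fun D _ χ => AssumptionA D χ →
      ‖∑ p ∈ primeWindow D, w D p * Φ D χ p - u * c * frakA χ * frakP D‖ ≤ ε * frakP D := by
  intro ε hε
  set M : ℝ := ‖u‖ + |Cw| + 1 with hM
  have hM0 : 0 < M := by positivity
  have hε1 : 0 < ε / (3 * M) := by positivity
  have hδ1 : 0 < ε / (3 * M * (‖c‖ + 1)) := by positivity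
  obtain ⟨D₂, h2⟩ := (hΦ _ hε1).and (hX _ hδ1)
  -- the third term: `|Cw|·α𝓛·‖c‖·𝔞 ≤ |Cw|‖c‖·16e⁹π·𝓛⁻⁴ ≤ ε/3` once `𝓛` is large
  set K : ℝ := 3 * (|Cw| * ‖c‖ * (16 * Real.exp 9) * π) / ε with hK
  obtain ⟨D₃, h3⟩ := exists_nat_forall_le_ell (max 3 (K + 1))
  refine ⟨max (max D₁ D₂) D₃, fun D _ χ hD hq hprim hA => ?_⟩
  have hD1 : D₁ ≤ D := le_trans (le_trans (le_max_left _ _) (le_max_left _ _)) hD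
  have hD2 : D₂ ≤ D := le_trans (le_trans (le_max_right _ _) (le_max_left _ _)) hD
  have hD3 : D₃ ≤ D := le_trans (le_max_right _ _) hD
  have hℓ3 : 3 ≤ ell D := le_trans (le_max_left _ _) (h3 D hD3)
  have hℓK : K + 1 ≤ ell D := le_trans (le_max_right _ _) (h3 D hD3)
  have hℓ0 : 0 < ell D := by linarith
  have hαℓ0 : 0 ≤ alpha D * ell D := mul_nonneg (alpha_pos' hℓ0).le hℓ0.le
  have hαℓ1 : alpha D * ell D ≤ 1 := alpha_mul_ell_le_one (by linarith)
  obtain ⟨eΦ, eX⟩ := h2 D χ hD2 hq hprim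
  have key := norm_window_sum_sub_le (w D) (Φ D χ) u c (X D χ) (frakA χ) (ε / (3 * M))
    (ε / (3 * M * (‖c‖ + 1))) (Cw * (alpha D * ell D)) (hw D hD1) (eΦ hA) (eX hA)
  refine key.trans (mul_le_mul_of_nonneg_right ?_ (frakP_nonneg D))
  -- sizes
  have hη : Cw * (alpha D * ell D) ≤ |Cw| := by
    calc Cw * (alpha D * ell D) ≤ |Cw| * (alpha D * ell D) :=
          mul_le_mul_of_nonneg_right (le_abs_self _) hαℓ0
      _ ≤ |Cw| * 1 := mul_le_mul_of_nonneg_left hαℓ1 (abs_nonneg _)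
      _ = |Cw| := mul_one _
  have huη : ‖u‖ + Cw * (alpha D * ell D) ≤ M := by rw [hM]; linarith
  have hA0 : 0 ≤ frakA χ := frakA_nonneg χ
  have hA4 : frakA χ ≤ 16 * Real.exp 9 * ell D ^ 4 := frakA_le_ell4 χ hprim hℓ3
  -- term 1
  have t1 : (‖u‖ + Cw * (alpha D * ell D)) * (ε / (3 * M)) ≤ ε / 3 := by
    calc (‖u‖ + Cw * (alpha D * ell D)) * (ε / (3 * M)) ≤ M * (ε / (3 * M)) :=
          mul_le_mul_of_nonneg_right huη hε1.le
      _ = ε / 3 := by field_simp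
  -- term 2
  have t2 : (‖u‖ + Cw * (alpha D * ell D)) * ‖c‖ * (ε / (3 * M * (‖c‖ + 1))) ≤ ε / 3 := by
    have hc1 : ‖c‖ ≤ ‖c‖ + 1 := by linarith
    calc (‖u‖ + Cw * (alpha D * ell D)) * ‖c‖ * (ε / (3 * M * (‖c‖ + 1)))
        ≤ M * (‖c‖ + 1) * (ε / (3 * M * (‖c‖ + 1))) := by
          refine mul_le_mul_of_nonneg_right ?_ hδ1.le
          exact mul_le_mul huη hc1 (norm_nonneg _) hM0.le
      _ = ε / 3 := by field_simp
  -- term 3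
  have t3 : Cw * (alpha D * ell D) * ‖c‖ * |frakA χ| ≤ ε / 3 := by
    rw [abs_of_nonneg hA0]
    have hαℓ5 : alpha D * ell D * ell D ^ 4 = π / ell D ^ 4 := by
      rw [alpha, log_bigP D]; field_simp
    have hℓ4 : ell D ≤ ell D ^ 4 := by
      calc ell D = ell D ^ 1 := (pow_one _).symm
        _ ≤ ell D ^ 4 := pow_le_pow_right₀ (by linarith) (by norm_num)
    have hKℓ : K ≤ ell D ^ 4 := by linarith
    have hK' : |Cw| * ‖c‖ * (16 * Real.exp 9) * π ≤ ε / 3 * ell D ^ 4 := by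
      have : |Cw| * ‖c‖ * (16 * Real.exp 9) * π = ε / 3 * K := by
        rw [hK]; field_simp
      rw [this]
      exact mul_le_mul_of_nonneg_left hKℓ (by positivity)
    calc Cw * (alpha D * ell D) * ‖c‖ * frakA χ
        ≤ |Cw| * (alpha D * ell D) * ‖c‖ * (16 * Real.exp 9 * ell D ^ 4) := by
          have h1 : Cw * (alpha D * ell D) * ‖c‖ ≤ |Cw| * (alpha D * ell D) * ‖c‖ :=
            mul_le_mul_of_nonneg_right (mul_le_mul_of_nonneg_right (le_abs_self _) hαℓ0)
              (norm_nonneg _)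
          exact mul_le_mul h1 hA4 hA0 (by positivity)
      _ = |Cw| * ‖c‖ * (16 * Real.exp 9) * (alpha D * ell D * ell D ^ 4) := by ring
      _ = |Cw| * ‖c‖ * (16 * Real.exp 9) * (π / ell D ^ 4) := by rw [hαℓ5]
      _ = (|Cw| * ‖c‖ * (16 * Real.exp 9) * π) / ell D ^ 4 := by ring
      _ ≤ (ε / 3 * ell D ^ 4) / ell D ^ 4 := by gcongr
      _ = ε / 3 := by field_simp
  linarith

/-- **`Σ_{p∼P}(pt₀)^{β₃}Φ(p) = −c·𝔞·𝔓 + o(𝔓)`** whenever `Φ(p) = c·p·X + o(p)` uniformly on the window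
and `X = 𝔞 + o(1)`: the step "(17.5) + (17.2) + Lemma 17.1 ⇒ (17.6)" (with `c = 𝔢₀`,
`X = Σ_{n<D⁴}ν(n)²/n`) and "(7.9) ⇒ …" of Prop. 7.1, `(pt₀)^{β₃} = −1 + O(α₁)` supplied by
`norm_pt0_cpow_beta3_add_one_le`. [cite: Zhang2022LandauSiegel, §17 (17.6)] -/
theorem window_sum_eval_beta3 (c' : ℝ)
    {Φ : (D : ℕ) → DirichletCharacter ℂ D → ℕ → ℂ} {X : (D : ℕ) → DirichletCharacter ℂ D → ℂ}
    {c : ℂ}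
    (hΦ : ∀ ε : ℝ, 0 < ε → ForAllLarge fun D _ χ => AssumptionA D χ →
      ∀ p ∈ primeWindow D, ‖Φ D χ p - c * p * X D χ‖ ≤ ε * p)
    (hX : ∀ δ : ℝ, 0 < δ → ForAllLarge fun D _ χ => AssumptionA D χ → ‖X D χ - frakA χ‖ ≤ δ) :
    ∀ ε : ℝ, 0 < ε → ForAllLarge fun D _ χ => AssumptionA D χ →
      ‖∑ p ∈ primeWindow D, (((p : ℝ) * t0 D : ℝ) : ℂ) ^ beta3 c' D * Φ D χ p +
          c * frakA χ * frakP D‖ ≤ ε * frakP D := by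
  obtain ⟨D₁, h1⟩ := exists_nat_forall_le_ell 2
  have hw : ∀ D : ℕ, D₁ ≤ D → ∀ p ∈ primeWindow D,
      ‖(((p : ℝ) * t0 D : ℝ) : ℂ) ^ beta3 c' D - (-1)‖ ≤
        3 * (520 + |c'| * (π + 520)) * (alpha D * ell D) := fun D hD p hp => by
    rw [sub_neg_eq_add]; exact norm_pt0_cpow_beta3_add_one_le c' (h1 D hD) hp
  intro ε hε
  refine (window_sum_eval hw hΦ hX ε hε).mono fun D _ χ _ _ h hA => ?_
  have := h hA
  rwa [show (-1 : ℂ) * c * frakA χ * frakP D = -(c * frakA χ * frakP D) by ring,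
    sub_neg_eq_add] at this

/-- **`Σ_{p∼P}(pt₀)^{β₁}Φ(p) = −c·𝔞·𝔓 + o(𝔓)`** under the same hypotheses: the step
"Since `(pt₀)^{β₁} = −1 + O(α₁)`, it follows by (16.2) that … (16.17)" of §16.
[cite: Zhang2022LandauSiegel, §16 (16.17)] -/
theorem window_sum_eval_beta1 (c' : ℝ)
    {Φ : (D : ℕ) → DirichletCharacter ℂ D → ℕ → ℂ} {X : (D : ℕ) → DirichletCharacter ℂ D → ℂ}
    {c : ℂ}
    (hΦ : ∀ ε : ℝ, 0 < ε → ForAllLarge fun D _ χ => AssumptionA D χ →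
      ∀ p ∈ primeWindow D, ‖Φ D χ p - c * p * X D χ‖ ≤ ε * p)
    (hX : ∀ δ : ℝ, 0 < δ → ForAllLarge fun D _ χ => AssumptionA D χ → ‖X D χ - frakA χ‖ ≤ δ) :
    ∀ ε : ℝ, 0 < ε → ForAllLarge fun D _ χ => AssumptionA D χ →
      ‖∑ p ∈ primeWindow D, (((p : ℝ) * t0 D : ℝ) : ℂ) ^ beta1 c' D * Φ D χ p +
          c * frakA χ * frakP D‖ ≤ ε * frakP D := by
  obtain ⟨D₁, h1⟩ := exists_nat_forall_le_ell 2
  have hw : ∀ D : ℕ, D₁ ≤ D → ∀ p ∈ primeWindow D,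
      ‖(((p : ℝ) * t0 D : ℝ) : ℂ) ^ beta1 c' D - (-1)‖ ≤
        (520 + 5 * |c'| * (π + 520)) * (alpha D * ell D) := fun D hD p hp => by
    rw [sub_neg_eq_add]; exact norm_pt0_cpow_beta1_add_one_le c' (h1 D hD) hp
  intro ε hε
  refine (window_sum_eval hw hΦ hX ε hε).mono fun D _ χ _ _ h hA => ?_
  have := h hA
  rwa [show (-1 : ℂ) * c * frakA χ * frakP D = -(c * frakA χ * frakP D) by ring,
    sub_neg_eq_add] at this

/-- **`Σ_{p∼P}(pt₀)^{β₂}Φ(p) = c·𝔞·𝔓 + o(𝔓)`** under the same hypotheses: the step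
"Since `(pt₀)^{β₂} = 1 + O(α₁)`, it follows by (17.7) that … (17.9)" of §17 (with `c = 𝔢₁`).
[cite: Zhang2022LandauSiegel, §17 (17.9)] -/
theorem window_sum_eval_beta2 (c' : ℝ)
    {Φ : (D : ℕ) → DirichletCharacter ℂ D → ℕ → ℂ} {X : (D : ℕ) → DirichletCharacter ℂ D → ℂ}
    {c : ℂ}
    (hΦ : ∀ ε : ℝ, 0 < ε → ForAllLarge fun D _ χ => AssumptionA D χ →
      ∀ p ∈ primeWindow D, ‖Φ D χ p - c * p * X D χ‖ ≤ ε * p)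
    (hX : ∀ δ : ℝ, 0 < δ → ForAllLarge fun D _ χ => AssumptionA D χ → ‖X D χ - frakA χ‖ ≤ δ) :
    ∀ ε : ℝ, 0 < ε → ForAllLarge fun D _ χ => AssumptionA D χ →
      ‖∑ p ∈ primeWindow D, (((p : ℝ) * t0 D : ℝ) : ℂ) ^ beta2 c' D * Φ D χ p -
          c * frakA χ * frakP D‖ ≤ ε * frakP D := by
  obtain ⟨D₁, h1⟩ := exists_nat_forall_le_ell 2
  have hw : ∀ D : ℕ, D₁ ≤ D → ∀ p ∈ primeWindow D,
      ‖(((p : ℝ) * t0 D : ℝ) : ℂ) ^ beta2 c' D - 1‖ ≤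
        2 * (520 + |c'| * (π + 520)) * (alpha D * ell D) := fun D hD p hp =>
    norm_pt0_cpow_beta2_sub_one_le c' (h1 D hD) hp
  intro ε hε
  refine (window_sum_eval hw hΦ hX ε hε).mono fun D _ χ _ _ h hA => ?_
  have := h hA
  rwa [one_mul] at this

/-- **Unweighted form**: `Φ(p) = c·p·X + o(p)` uniformly on the window and `X = 𝔞 + o(1)` give
`Σ_{p∼P} Φ(p) = c·𝔞·𝔓 + o(𝔓)` (the summation over `p ∼ P` of (16.4)→(16.16), (17.5), (17.8) before the
`(pt₀)^{β}` factor is attached). [cite: Zhang2022LandauSiegel, §16 (16.16)] -/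
theorem window_sum_eval_one
    {Φ : (D : ℕ) → DirichletCharacter ℂ D → ℕ → ℂ} {X : (D : ℕ) → DirichletCharacter ℂ D → ℂ}
    {c : ℂ}
    (hΦ : ∀ ε : ℝ, 0 < ε → ForAllLarge fun D _ χ => AssumptionA D χ →
      ∀ p ∈ primeWindow D, ‖Φ D χ p - c * p * X D χ‖ ≤ ε * p)
    (hX : ∀ δ : ℝ, 0 < δ → ForAllLarge fun D _ χ => AssumptionA D χ → ‖X D χ - frakA χ‖ ≤ δ) :
    ∀ ε : ℝ, 0 < ε → ForAllLarge fun D _ χ => AssumptionA D χ →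
      ‖∑ p ∈ primeWindow D, Φ D χ p - c * frakA χ * frakP D‖ ≤ ε * frakP D := by
  have hw : ∀ D : ℕ, 0 ≤ D → ∀ p ∈ primeWindow D, ‖(fun (_ : ℕ) (_ : ℕ) => (1 : ℂ)) D p - 1‖ ≤
      0 * (alpha D * ell D) := fun D _ p _ => by simp
  intro ε hε
  refine (window_sum_eval hw hΦ hX ε hε).mono fun D _ χ _ _ h hA => ?_
  have := h hA
  simpa only [one_mul] using this

/-- **Lemma 17.1 in the `o(1)` shape consumed above**, complex-valued with `ν(n)²`
(`= |ν(n)|²`, `χ` real): `X_{D,χ} = Σ_{n<D⁴} ν(n)²/n` satisfies `X = 𝔞 + o(1)` under (A), from the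
tree's theorem `appBLemma171_holds` (rate `𝓛⁻²⁰¹¹`). [cite: Zhang2022LandauSiegel, §17 Lemma 17.1] -/
theorem sum_nu_sq_div_eventually :
    ∀ δ : ℝ, 0 < δ → ForAllLarge fun D _ χ => AssumptionA D χ →
      ‖(∑ n ∈ Finset.range (D ^ 4), nu χ n ^ 2 / (n : ℂ)) - frakA χ‖ ≤ δ := by
  intro δ hδ
  obtain ⟨C, D₀, hC⟩ := appBLemma171_holds
  obtain ⟨D₃, h3⟩ := exists_nat_forall_le_ell (max 1 (|C| / δ))
  refine ⟨max D₀ D₃, fun D _ χ hD hq hprim hA => ?_⟩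
  have hD0 : D₀ ≤ D := le_trans (le_max_left _ _) hD
  have hℓ := h3 D (le_trans (le_max_right _ _) hD)
  have hℓ1 : 1 ≤ ell D := le_trans (le_max_left _ _) hℓ
  have hℓC : |C| / δ ≤ ell D := le_trans (le_max_right _ _) hℓ
  have key := hC D χ hD0 hq hprim hA
  -- the complex sum is the real sum
  have hsum : (∑ n ∈ Finset.range (D ^ 4), nu χ n ^ 2 / (n : ℂ)) =
      ((∑ n ∈ Finset.range (D ^ 4), ‖nu χ n‖ ^ 2 / n : ℝ) : ℂ) := by
    rw [Complex.ofReal_sum]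
    refine Finset.sum_congr rfl fun n _ => ?_
    rw [nu, Lemma31.divisorSumChar_sq_eq χ hq.sq_eq_one n]
    push_cast
    rfl
  rw [hsum, ← Complex.ofReal_sub, Complex.norm_real, Real.norm_eq_abs]
  refine key.trans ?_
  have hℓpow : ell D ≤ ell D ^ 2011 := by
    calc ell D = ell D ^ 1 := (pow_one _).symm
      _ ≤ ell D ^ 2011 := pow_le_pow_right₀ hℓ1 (by norm_num)
  have hpos : 0 < ell D ^ 2011 := by positivity
  rw [div_le_iff₀ hpos]
  calc C ≤ |C| := le_abs_self C
    _ = |C| / δ * δ := by field_simp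
    _ ≤ ell D * δ := mul_le_mul_of_nonneg_right hℓC hδ.le
    _ ≤ ell D ^ 2011 * δ := mul_le_mul_of_nonneg_right hℓpow hδ.le
    _ = δ * ell D ^ 2011 := mul_comm _ _

end Literature.NumberTheory.LFunctions.Zhang2022.Skeleton
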